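import Literature.Probability.RandomPlanarGeometry.HexSAWPolygonStepTwoReadings
import Literature.Probability.RandomPlanarGeometry.HexSAWPolygonCellsOmegaReadings
import HarnessLib

/-!
# XLIV — the step two `q_N(ℍ) ≤ q_{N+2}(ℍ)` for every even `N ≥ 12`: THEOREM I completed (injectivity of OMEGA)

Topic `Literature/Probability/RandomPlanarGeometry` (lane «pcv-sawmu», a-p4 g23; sequel of XL `HexSAWPolygonStepTwoReadings`
(`hexPolygonNumber_le_add_two_of_readings`), XXXIX `…OmegaInjSkeleton` (`omegaImage_injective_of_readings`), XLI `…OmegaPorts`, XLII `…OmegaDecode` and XLIII `…OmegaReadings`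
(`eq_decode_of_case2`, `leaf_shape_of_case2`)).

The two reading hypotheses (R2)/(R3) of THEOREM I (THEOREM-OMEGA-g21 §4) are discharged:
* ★ `contacts_of_rayTop` — at a top hexagon `w` of `W = ι S` OUTSIDE the base image (a ray top, CASE 1), `w` is a leaf of `W` whose contact is `LL w`, or
  `LR w` with `L² (LR w) ∈ W` (a one-hexagon ray on a `UL`-type port of the RU leaf);
* ★★ `case1Exclusive` — (R3): if `w ∉ C(peel S₁)` then `w ∉ C(peel S₂)` (a base-image top is thick, or a leaf with `LL w ∉ W`, `L² (LR w) ∉ W` — XLIII);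
* ★★ `case2Reading` — (R2): if `w ∈ C(peel S₁)` then `S₁ = S₂` (both sides are in CASE 2 and `S_i = decode W w` — XLIII);
* ★★★ `omegaImage_injective` — THEOREM I: `ι` is injective on admissible brick sets;
* ★★★★ **`hexPolygonNumber_le_add_two`** — for every even `N ≥ 12`, `hexPolygonNumber N ≤ hexPolygonNumber (N + 2)`: the number of `N`-step honeycomb
  polygons per site is non-decreasing along the even integers from `N = 12` on (false at `N = 6, 10`: `HexSAWPolygonCensus.not_hexPolygonNumber_le_add_two`).
  The injection `N`-gons → `(N+2)`-gons is the Madras–Slade surgery at the largest point (Thm 3.2.3 of [MadrasSlade1993], on `ℤ^d`) transplanted to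
  the honeycomb lattice as the map OMEGA of THEOREM-OMEGA-g21 (units re-grown along up-right rays over the base image), mechanised in the chain XVII–XLIII.

Sources: N. Madras, G. Slade, *The Self-Avoiding Walk* (1993), §3.2, Theorem 3.2.3 (3.2.3) p. 64 and its proof pp. 64–65 [MadrasSlade1993]; I. Jensen,
J. Phys.: Conf. Ser. 42 (2006) 163, §2 (honeycomb polygon enumeration by perimeter) [Jensen2006HoneycombPolygons].  Label (lane): LANE THEOREM — the
lane's open item `q_N(ℍ) ≤ q_{N+2}(ℍ)` (even `N ≥ 12`) is now a theorem; the transplanted monotonicity is the lane's result, not a claim of the sources.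
-/

open Finset

namespace Literature.Probability.RandomPlanarGeometry.SAW

namespace HexCell

open HexBW

/-! ### The top of CASE 1: a ray top and its contact -/

/-- ★ **The contact of a ray top.** If the top hexagon `w` of `W = ι S` is not in the base image, then `w` has exactly one contact in `W`, and either
`LL w ∈ W` (the hexagon below it on its ray, or the contact of a `UR`-type port) or `LR w ∈ W` with `L (L (LR w)) ∈ W` (a one-hexagon ray on a leaf port
`UL c_i`, `i < j`, whose contact is `c_i` with `c_{i+1} = L² c_i` in the base). [cite: MadrasSlade1993, §3.2 (proof of Theorem 3.2.3)] -/
theorem contacts_of_rayTop {S : Finset Cell} {w : Cell} (hS : IsBrickSet S) (hP : IsPolygon brickWallGraph (bdry S)) (h2 : 2 ≤ #(peel S))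
    (hw : IsLexmax (omegaImage S) w) (hwC : w ∉ baseImage (peel S)) :
    #(nbrs w ∩ omegaImage S) = 1 ∧ (LL w ∈ omegaImage S ∨ (LR w ∈ omegaImage S ∧ L (L (LR w)) ∈ omegaImage S)) := by
  classical
  obtain ⟨hb, hpoly, hfix⟩ := peel_hyps hS hP
  obtain ⟨hinv, hperim, -⟩ := base_data hb hpoly h2 hfix
  have hX := omega_hX hS
  obtain ⟨c, hc, hur, hwc⟩ := exists_stickTop_of_lexmax_image (C := baseImage) (P₀ := basePort) hw.1 hwC hw.2
  refine ⟨by rw [hwc]; exact card_contacts_rayTop hS h2 hX hinv hperim hc hur, ?_⟩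
  obtain ⟨h, i, hhost, hi, hci, hst⟩ := exists_host_stick_of_mem_sdiff_peel hc
  obtain ⟨i, rfl⟩ : ∃ i', i = i' + 1 := ⟨i - 1, by omega⟩
  rw [← hci, ll_omegaRec_port_urIter_succ hhost.1 hst] at hwc
  have hIW : baseImage (peel S) ⊆ omegaImage S := baseImage_subset_omegaImage S
  rcases Nat.eq_zero_or_pos i with rfl | hpos
  · -- a one-hexagon ray: `w` is the port itself
    rw [urIter_zero] at hwc
    rcases ll_basePort_mem_or hb hpoly h2 hfix hhost.1 with hmem | ⟨hUL, hhC, hL2⟩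
    · left; rw [hwc]; exact hIW hmem
    · right
      have eLR : LR w = h := by rw [hwc, hUL]; exact Prod.ext (by simp) (by simp)
      rw [eLR]; exact ⟨hIW hhC, hIW hL2⟩
  · -- a longer ray: `LL w` is the previous ray hexagon, the image of the stick hexagon `UR^i h`
    left
    obtain ⟨i, rfl⟩ : ∃ i', i = i' + 1 := ⟨i - 1, by omega⟩
    have hst' : ∀ j, 1 ≤ j → j ≤ i + 1 → urIter h j ∈ S \ peel S := fun j hj1 hj2 => hst j hj1 (by omega)
    rw [hwc, urIter_succ, ll_ur, ← ll_omegaRec_port_urIter_succ (C := baseImage) (P₀ := basePort) hhost.1 hst', omegaImage, omegaRec_image_eq]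
    exact mem_union_right _ (mem_image_of_mem _ (hst' (i + 1) (by omega) le_rfl))

/-! ### (R3) and (R2) -/

/-- ★★ **(R3) CASE-1 exclusivity**: with `ι S₁ = ι S₂` and `w` the top hexagon of the common image, if `w` is outside the base image of `S₁` then it is
outside that of `S₂`. [cite: MadrasSlade1993, §3.2 (proof of Theorem 3.2.3)] -/
theorem case1Exclusive : ∀ S₁ S₂ : Finset Cell, ∀ w : Cell, Adm S₁ → Adm S₂ → omegaImage S₁ = omegaImage S₂ → IsLexmax (omegaImage S₁) w →
    w ∉ baseImage (peel S₁) → w ∉ baseImage (peel S₂) := by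
  intro S₁ S₂ w h₁ h₂ heq hw hwC₁ hwC₂
  obtain ⟨hone, hcontact⟩ := contacts_of_rayTop h₁.1 h₁.2.1 h₁.2.2 hw hwC₁
  have hw₂ : IsLexmax (omegaImage S₂) w := heq ▸ hw
  by_cases hthick : 2 ≤ #(nbrs w ∩ omegaImage S₂)
  · rw [← heq] at hthick; omega
  · obtain ⟨hLL, hL2⟩ := leaf_shape_of_case2 h₂.1 h₂.2.1 h₂.2.2 hw₂ hwC₂ hthick
    rw [← heq] at hLL hL2
    rcases hcontact with h | ⟨-, h⟩
    · exact hLL h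
    · exact hL2 h

/-- ★★ **(R2) CASE-2 reading**: with `ι S₁ = ι S₂` and the top hexagon `w` in the base image of `S₁`, `S₁ = S₂` — both sides are in CASE 2 (by (R3)) and
both equal `decode (ι S_i) w`.  (The induction hypothesis offered by the skeleton is not needed.) [cite: MadrasSlade1993, §3.2 (proof of Theorem 3.2.3)] -/
theorem case2Reading : ∀ S₁ S₂ : Finset Cell, ∀ w : Cell, Adm S₁ → Adm S₂ → omegaImage S₁ = omegaImage S₂ → IsLexmax (omegaImage S₁) w →
    w ∈ baseImage (peel S₁) →
    (∀ T₁ T₂ : Finset Cell, Adm T₁ → Adm T₂ → #T₁ < #S₁ → omegaImage T₁ = omegaImage T₂ → T₁ = T₂) → S₁ = S₂ := by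
  intro S₁ S₂ w h₁ h₂ heq hw hwC₁ _
  have hw₂ : IsLexmax (omegaImage S₂) w := heq ▸ hw
  have hwC₂ : w ∈ baseImage (peel S₂) := by
    by_contra h
    exact case1Exclusive S₂ S₁ w h₂ h₁ heq.symm hw₂ h hwC₁
  rw [eq_decode_of_case2 h₁.1 h₁.2.1 h₁.2.2 hw hwC₁, eq_decode_of_case2 h₂.1 h₂.2.1 h₂.2.2 hw₂ hwC₂, heq]

/-! ### THEOREM I and the step two -/

/-- ★★★ **THEOREM I (injectivity of OMEGA)**: on admissible brick sets (polygonal boundary, base with at least two hexagons) the map `ι = omegaImage` is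
injective. [cite: MadrasSlade1993, §3.2, Theorem 3.2.3 (3.2.3) and its proof pp. 64–65 (the surgery is reversible from the image)] -/
theorem omegaImage_injective : ∀ S₁ S₂ : Finset Cell, Adm S₁ → Adm S₂ → omegaImage S₁ = omegaImage S₂ → S₁ = S₂ :=
  omegaImage_injective_of_readings case2Reading case1Exclusive

/-- ★★★★ **The step two for honeycomb polygons: `q_N(ℍ) ≤ q_{N+2}(ℍ)` for every even `N ≥ 12`.**  The number of `N`-step self-avoiding polygons of the
honeycomb lattice per site, `hexPolygonNumber N`, does not decrease from `N` to `N + 2` once `N ≥ 12` (it does at `N = 6` and `N = 10`: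
`HexSAWPolygonCensus.not_hexPolygonNumber_le_add_two`).  Proof: the injection OMEGA from `N`-gons to `(N+2)`-gons (THEOREM V, XXX; THEOREM I above),
counted over canonical rooted polygons (XXXII). [cite: MadrasSlade1993, §3.2, Theorem 3.2.3 (3.2.3) p. 64 (`ℤ^d`; transplanted to `ℍ` — lane result)]
[cite: Jensen2006HoneycombPolygons, §2 (honeycomb polygons enumerated by perimeter)] -/
theorem hexPolygonNumber_le_add_two {N : ℕ} (hN : 12 ≤ N) (hE : Even N) : hexPolygonNumber N ≤ hexPolygonNumber (N + 2) :=
  hexPolygonNumber_le_add_two_of_readings case2Reading case1Exclusive hN hE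

end HexCell

end Literature.Probability.RandomPlanarGeometry.SAW
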